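import Summits.CriticalPhenomena.PercolationContinuityZ3.Theorems.PercAnnulusCrossingSetToSetQuasiMultReduction
import Literature.Probability.Percolation.BlockExplorationBasic
import Literature.Probability.Percolation.UniquenessZone
import HarnessLib

/-!
# Kesten–Basu–Sapozhnikov IIC scheme in boxes, II: the exploration datum, its rim, and the arm (lane RSW3, p1 gen 3)

builds on p205010 (kernel theorem, internal audit signed; external expert review pending)

Seat `prim-rsw3-p1` (gen 3); LANE-4 blueprint, memo `run/shared/lean/prim/rsw3/P1-QM.md` §13.4 step (1).  Helper file; no definitions,
no sorries; every `p`, every `d`.  Basu–Sapozhnikov (ECP 22 (2017) no. 26, §2 eq. (2.3)) decompose `{0 ↔ ∂Λ(n)}` at the explored set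
`𝒞 = Λ(a) ∪ {x ∈ Λ(b) : x ↔ Λ(a) in Λ(b)}` with rim `𝒟` (tree: `explSet`, `explRim`, `explEvent` of `L/BlockExploration.lean`, here read on the
configuration TRUNCATED to the pairs of `Λ(b+1)`, so that every event is determined by finitely many pairs).  Data `U ⊆ Λ(b)`, `R ⊆ Λ(b+1)`;
events (written out): `DAT(U,R)` (datum), `LINK(U,R)` (every two rim vertices hang, by open edges, off two vertices of `U` joined inside `U` —
Basu–Sapozhnikov's uniqueness event read on the datum), `LEFT(U,R)` (`0` joined inside `U` to a vertex with an open edge to the rim),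
`RIGHT(U,R,n)` (some rim vertex joined to `∂ⁱⁿΛ(n)` inside `Λ(n) ∖ U`).
* `mem_dat_iff_mem_explEvent` — on lattice configurations the truncation is immaterial; `rim_facts_of_mem_dat`;
* **`siteToBoundary_iff_left_and_right`** — on `DAT ∩ LINK` (lattice): `{0 ↔ ∂ⁱⁿΛ(n)} ⟺ LEFT ∧ RIGHT` (first exit from `U` lands in the rim;
  the last visit to `U ∪ R` is a rim vertex; conversely glue through `LINK`) — (E7) of `BlockExplorationBasic.lean` inside `Λ(n)`;
* `determinedBy_dat`, `determinedBy_link`, `determinedBy_left` (pairs of `Λ(b+1)` touching `U`), `determinedBy_right` (pairs of `Λ(n) ∖ U`),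
  `disjoint_touching_sdiff` (the two sides are disjoint);
* `link_of_dat_of_uniqZone` — `DAT(U,R) ∩ uniqZone a b ⊆ LINK(U,R)` (lattice): the complement of `LINK` on the datum costs at most
  `P({0 ↔ ∂ⁱⁿΛ(n)} ∖ uniqZone a b)` (bounded in `PercAnnulusCrossingIICUniquenessJunk.lean`).
The product and sum formulas (Basu–Sapozhnikov (2.5)) are in `PercAnnulusCrossingIICOneLevelDecomposition.lean`.
References: D. Basu, A. Sapozhnikov, ECP 22 (2017) no. 26, §2 (2.3)–(2.5); H. Kesten, PTRF 73 (1986) §2; G. Grimmett (1999), §2.2.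
-/

noncomputable section

namespace Summit.CriticalPhenomena.PercolationContinuityZ3.Theorems.Crossing

open MeasureTheory Literature.Probability.Percolation Literature.Probability.LatticeModels
open Literature.Probability.Percolation.DCT16
open Summit.CriticalPhenomena.PercolationContinuityZ3.Theorems.SurfaceTension

variable {d : ℕ}

/-! ## Lattice bookkeeping -/

/-- `Λ(a) ∪ (Λ(b) ∖ Λ(a)) = Λ(b)` for `a ≤ b`. [folklore] -/
theorem coe_box_union_sdiff {a b : ℕ} (hab : a ≤ b) :
    (↑(box d a) : Set (Site d)) ∪ ((↑(box d b) : Set (Site d)) \ ↑(box d a)) = ↑(box d b) :=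
  Set.union_sdiff_cancel (Finset.coe_subset.2 (box_mono d hab))

/-- A lattice pair with an endpoint in `Λ(b)` is a pair of sites of `Λ(b+1)`. [folklore] -/
theorem mem_sym2_box_succ_of_mem_edgeSet {b : ℕ} {e : Sym2 (Site d)} (he : e ∈ (zdGraph d).edgeSet)
    (hv : ∃ v ∈ box d b, v ∈ e) : e ∈ (↑((box d (b + 1)).sym2) : Set (Sym2 (Site d))) := by
  obtain ⟨v, hv, hve⟩ := hv
  induction e using Sym2.ind with
  | h x y =>
    rw [Finset.coe_sym2, Set.mk_mem_sym2_iff, Finset.mem_coe, Finset.mem_coe]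
    rw [SimpleGraph.mem_edgeSet] at he
    rcases Sym2.mem_iff.1 hve with rfl | rfl
    · exact ⟨box_mono d (by omega) hv, mem_box_succ_of_adj_box he hv⟩
    · exact ⟨mem_box_succ_of_adj_box he.symm hv, box_mono d (by omega) hv⟩

/-- On a lattice configuration, the pairs touching a subset `U ⊆ Λ(b)` are the same before and after truncation to the pairs of
`Λ(b+1)`. [folklore] -/
theorem agree_on_touching_of_subset_edgeSet {b : ℕ} {U : Finset (Site d)} (hUb : U ⊆ box d b)
    {ω : BondConfig (Site d)} (hω : ω ⊆ (zdGraph d).edgeSet) :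
    ∀ e : Sym2 (Site d), (∃ v ∈ (↑U : Set (Site d)), v ∈ e) →
      (e ∈ ω ↔ e ∈ ω ∩ (↑((box d (b + 1)).sym2) : Set (Sym2 (Site d)))) := by
  intro e hv
  refine ⟨fun he => ⟨he, ?_⟩, fun he => he.1⟩
  obtain ⟨v, hvU, hve⟩ := hv
  exact mem_sym2_box_succ_of_mem_edgeSet (hω he) ⟨v, hUb (Finset.mem_coe.1 hvU), hve⟩

/-- **The truncation is immaterial on lattice configurations**: for `U ⊆ Λ(b)` and `ω ⊆ E(ℤ^d)`,
`ω ∩ (pairs of Λ(b+1)) ∈ explEvent In Blk U R ↔ ω ∈ explEvent In Blk U R`. [cite: BasuSapozhnikov2017ECP, §2 eq. (2.3)] -/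
theorem mem_dat_iff_mem_explEvent {a b : ℕ} {U R : Finset (Site d)} (hUb : U ⊆ box d b)
    {ω : BondConfig (Site d)} (hω : ω ⊆ (zdGraph d).edgeSet) :
    ω ∩ (↑((box d (b + 1)).sym2) : Set (Sym2 (Site d))) ∈
        explEvent (↑(box d a) : Set (Site d)) ((↑(box d b) : Set (Site d)) \ ↑(box d a)) ↑U ↑R ↔
      ω ∈ explEvent (↑(box d a) : Set (Site d)) ((↑(box d b) : Set (Site d)) \ ↑(box d a)) ↑U ↑R :=
  (mem_explEvent_iff_of_agree_on_touching (agree_on_touching_of_subset_edgeSet hUb hω)).symm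

/-! ## The identity `{0 ↔ ∂ⁱⁿΛ(n)} = LEFT ∩ RIGHT` on `DAT ∩ LINK` -/

/-- On the datum event (lattice configuration, `U ⊆ Λ(b)`): every `r ∈ R` lies outside `U` and outside `Λ(b)`, inside `Λ(b+1)`, and every
open edge from `U` to a vertex outside `U` ends in `R`. [cite: BasuSapozhnikov2017ECP, §2 eq. (2.3)] -/
theorem rim_facts_of_mem_dat {a b : ℕ} (hab : a ≤ b) {U R : Finset (Site d)} (hUb : U ⊆ box d b)
    {ω : BondConfig (Site d)} (hω : ω ⊆ (zdGraph d).edgeSet)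
    (hD : ω ∩ (↑((box d (b + 1)).sym2) : Set (Sym2 (Site d))) ∈
      explEvent (↑(box d a) : Set (Site d)) ((↑(box d b) : Set (Site d)) \ ↑(box d a)) ↑U ↑R) :
    (∀ r ∈ R, r ∉ U ∧ r ∉ box d b ∧ r ∈ box d (b + 1)) ∧
      ∀ v ∈ U, ∀ w : Site d, s(v, w) ∈ ω → w ∉ U → w ∈ R := by
  have hD' := (mem_dat_iff_mem_explEvent (a := a) (R := R) hUb hω).1 hD
  obtain ⟨hSet, hRim⟩ := mem_explEvent_iff.1 hD'
  refine ⟨fun r hr => ?_, fun v hv w hvw hwU => ?_⟩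
  · have hr' : r ∈ explRim (↑(box d a) : Set (Site d)) ((↑(box d b) : Set (Site d)) \ ↑(box d a)) ω := by
      rw [hRim]; exact Finset.mem_coe.2 hr
    obtain ⟨hrU, v, hv, hvr⟩ := mem_explRim_iff.1 hr'
    rw [hSet] at hrU hv
    have hrb : r ∉ box d b := fun h => explRim_disjoint hr' (by
      rw [coe_box_union_sdiff (d := d) hab]; exact Finset.mem_coe.2 h)
    have hadj : (zdGraph d).Adj v r := by
      have := hω hvr; rwa [SimpleGraph.mem_edgeSet] at this
    exact ⟨fun h => hrU (Finset.mem_coe.2 h), hrb, mem_box_succ_of_adj_box hadj (hUb (Finset.mem_coe.1 hv))⟩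
  · exact Finset.mem_coe.1 (mem_of_mem_explEvent_of_open_edge hD' (Finset.mem_coe.2 hv) hvw (fun h => hwU (Finset.mem_coe.1 h)))

/-- **Decomposition of the arm at the explored set.**  Let `b + 1 < n`, `Λ(a) ⊆ U ⊆ Λ(b)`, and let the lattice configuration `ω` lie in
`DAT(U,R) ∩ LINK(U,R)`.  Then `0 ↔ ∂ⁱⁿΛ(n)` in `Λ(n)` iff [`0` is joined INSIDE `U` to a vertex carrying an open edge to a rim vertex] and
[some rim vertex is joined to `∂ⁱⁿΛ(n)` inside `Λ(n) ∖ U`] (⇒: the first exit from `U` is an open edge into the rim; the last vertex on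
`U ∪ R` is a rim vertex, after which the arm avoids `U`; ⇐: glue through `LINK`). [cite: BasuSapozhnikov2017ECP, §2, paragraph after eq. (2.3)] -/
theorem siteToBoundary_iff_left_and_right {a b n : ℕ} (hab : a ≤ b) (hbn : b + 1 < n) {U R : Finset (Site d)}
    (hUa : box d a ⊆ U) (hUb : U ⊆ box d b) {ω : BondConfig (Site d)} (hω : ω ⊆ (zdGraph d).edgeSet)
    (hD : ω ∩ (↑((box d (b + 1)).sym2) : Set (Sym2 (Site d))) ∈
      explEvent (↑(box d a) : Set (Site d)) ((↑(box d b) : Set (Site d)) \ ↑(box d a)) ↑U ↑R)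
    (hL : ω ∈ {ω : BondConfig (Site d) | ∀ r ∈ R, ∀ r' ∈ R, ∃ v ∈ U, ∃ v' ∈ U,
      s(v, r) ∈ ω ∧ s(v', r') ∈ ω ∧ ω ∈ openConnIn (↑U : Set (Site d)) v v'}) :
    ω ∈ siteToBoundary d n ↔
      ω ∈ {ω : BondConfig (Site d) | ∃ r ∈ R, ∃ v ∈ U, ω ∈ openConnIn (↑U : Set (Site d)) 0 v ∧ s(v, r) ∈ ω} ∧
        ω ∈ {ω : BondConfig (Site d) | ∃ r ∈ R, ∃ t ∈ innerBoundary (zdGraph d) (box d n),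
          ω ∈ openConnIn ((↑(box d n) : Set (Site d)) \ ↑U) r t} := by
  obtain ⟨hRfacts, hedge⟩ := rim_facts_of_mem_dat hab hUb hω hD
  have hUn : (↑U : Set (Site d)) ⊆ ↑(box d n) :=
    Finset.coe_subset.2 (hUb.trans (box_mono d (by omega)))
  have hRn : ∀ r ∈ R, r ∈ (↑(box d n) : Set (Site d)) := fun r hr =>
    Finset.mem_coe.2 (box_mono d (by omega) (hRfacts r hr).2.2)
  constructor
  · rintro ⟨t, ht, h0t⟩
    have hP := pathIn_of_mem_openConnIn h0t
    have h0U : (0 : Site d) ∈ (↑U : Set (Site d)) := Finset.mem_coe.2 (hUa (zero_mem_box d a))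
    have htb1 : t ∉ box d (b + 1) := notMem_box_of_mem_innerBoundary_box hbn ht
    have htU : t ∉ (↑U : Set (Site d)) := fun h => htb1 (box_mono d (by omega) (hUb (Finset.mem_coe.1 h)))
    constructor
    · -- first exit from `U`
      obtain ⟨v, r, hv, hrU, -, hadj, hpre⟩ := hP.exit h0U htU
      rw [openGraph_adj] at hadj
      have hrR : r ∈ R := hedge v (Finset.mem_coe.1 hv) r hadj.1 (fun h => hrU (Finset.mem_coe.2 h))
      exact ⟨r, hrR, v, Finset.mem_coe.1 hv, mem_openConnIn_of_pathIn (hpre.mono Set.inter_subset_left), hadj.1⟩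
    · -- last visit to `U ∪ R`
      have htC : t ∉ (↑U : Set (Site d)) ∪ ↑R := by
        rintro (h | h)
        · exact htU h
        · exact htb1 (hRfacts t (Finset.mem_coe.1 h)).2.2
      obtain ⟨r, w, hrC, hrn, hwC, hadj, hsuf⟩ := hP.last_exit (C := (↑U : Set (Site d)) ∪ ↑R) (Or.inl h0U) htC
      rw [openGraph_adj] at hadj
      have hrR : r ∈ R := by
        rcases hrC with hrU | hrR
        · have hwR : w ∈ R :=
            hedge r (Finset.mem_coe.1 hrU) w hadj.1 (fun h => hwC (Or.inl (Finset.mem_coe.2 h)))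
          exact absurd (show w ∈ (↑U : Set (Site d)) ∪ ↑R from Or.inr (Finset.mem_coe.2 hwR)) hwC
        · exact Finset.mem_coe.1 hrR
      have hrU : r ∉ (↑U : Set (Site d)) := fun h => (hRfacts r hrR).1 (Finset.mem_coe.1 h)
      refine ⟨r, hrR, t, ht, mem_openConnIn_of_pathIn ?_⟩
      have hw : w ∈ (↑(box d n) : Set (Site d)) \ ↑U := ⟨hsuf.left_mem.1, fun h => hwC (Or.inl h)⟩
      have hr' : r ∈ (↑(box d n) : Set (Site d)) \ ↑U := ⟨hrn, hrU⟩
      exact (PathIn.of_adj hr' hw ((openGraph_adj ω r w).2 hadj)).trans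
        (hsuf.mono fun z hz => ⟨hz.1, fun h => hz.2 (Or.inl h)⟩)
  · rintro ⟨⟨r, hr, v, hv, h0v, hvr⟩, r', hr', t, ht, hr't⟩
    obtain ⟨v₂, hv₂, v₂', hv₂', hv₂r, hv₂'r', hvv⟩ := hL r hr r' hr'
    have ne_of_mem : ∀ {x y : Site d}, s(x, y) ∈ ω → x ≠ y := fun he =>
      (show (zdGraph d).Adj _ _ by have := hω he; rwa [SimpleGraph.mem_edgeSet] at this).ne
    refine ⟨t, ht, ?_⟩
    have h1 : ω ∈ openConnIn (↑(box d n) : Set (Site d)) 0 v := openConnIn_mono hUn _ _ h0v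
    have h2 : ω ∈ openConnIn (↑(box d n) : Set (Site d)) v r :=
      openConnIn_of_adj (hUn (Finset.mem_coe.2 hv)) (hRn r hr) hvr (ne_of_mem hvr)
    have h3 : ω ∈ openConnIn (↑(box d n) : Set (Site d)) r v₂ := by
      rw [openConnIn_comm]
      exact openConnIn_of_adj (hUn (Finset.mem_coe.2 hv₂)) (hRn r hr) hv₂r (ne_of_mem hv₂r)
    have h4 : ω ∈ openConnIn (↑(box d n) : Set (Site d)) v₂ v₂' := openConnIn_mono hUn _ _ hvv
    have h5 : ω ∈ openConnIn (↑(box d n) : Set (Site d)) v₂' r' :=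
      openConnIn_of_adj (hUn (Finset.mem_coe.2 hv₂')) (hRn r' hr') hv₂'r' (ne_of_mem hv₂'r')
    have h6 : ω ∈ openConnIn (↑(box d n) : Set (Site d)) r' t := openConnIn_mono (fun z hz => hz.1) _ _ hr't
    exact PlanarDuality.openConnIn_trans (PlanarDuality.openConnIn_trans (PlanarDuality.openConnIn_trans
      (PlanarDuality.openConnIn_trans (PlanarDuality.openConnIn_trans h1 h2) h3) h4) h5) h6

/-! ## The events are determined by finitely many pairs, on disjoint sides of `U` -/

/-- Agreement on a set of pairs gives agreement on each of its members. [folklore] -/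
theorem iff_of_inter_eq {T : Set (Sym2 (Site d))} {ω ω' : BondConfig (Site d)} (h : ω ∩ T = ω' ∩ T)
    {e : Sym2 (Site d)} (he : e ∈ T) : e ∈ ω ↔ e ∈ ω' :=
  ⟨fun h1 => ((Set.ext_iff.1 h e).1 ⟨h1, he⟩).1, fun h1 => ((Set.ext_iff.1 h e).2 ⟨h1, he⟩).1⟩

/-- A pair with an endpoint in `U ⊆ Λ(b)` and the other in `Λ(b+1)` is a pair of `Λ(b+1)` touching `U`. [folklore] -/
theorem mem_touching {b : ℕ} {U : Finset (Site d)} (hUb : U ⊆ box d b) {v w : Site d} (hv : v ∈ U) (hw : w ∈ box d (b + 1)) :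
    s(v, w) ∈ {e : Sym2 (Site d) | e ∈ (↑((box d (b + 1)).sym2) : Set (Sym2 (Site d))) ∧ ∃ u ∈ (↑U : Set (Site d)), u ∈ e} := by
  refine ⟨?_, v, Finset.mem_coe.2 hv, Sym2.mem_mk_left v w⟩
  rw [Finset.coe_sym2, Set.mk_mem_sym2_iff]
  exact ⟨Finset.mem_coe.2 (box_mono d (by omega) (hUb hv)), Finset.mem_coe.2 hw⟩

/-- **`DAT(U,R)` is determined by the pairs of `Λ(b+1)` touching `U`** ((E2) of `BlockExplorationBasic.lean` after truncation).
[cite: BasuSapozhnikov2017ECP, §2, paragraph after eq. (2.3)] -/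
theorem determinedBy_dat (a b : ℕ) (U R : Finset (Site d)) :
    DeterminedBy {ω : BondConfig (Site d) | ω ∩ (↑((box d (b + 1)).sym2) : Set (Sym2 (Site d))) ∈
        explEvent (↑(box d a) : Set (Site d)) ((↑(box d b) : Set (Site d)) \ ↑(box d a)) ↑U ↑R}
      {e : Sym2 (Site d) | e ∈ (↑((box d (b + 1)).sym2) : Set (Sym2 (Site d))) ∧ ∃ u ∈ (↑U : Set (Site d)), u ∈ e} := by
  rw [determinedBy_iff]
  intro ω ω' h
  refine mem_explEvent_iff_of_agree_on_touching fun e he => ?_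
  by_cases heK : e ∈ (↑((box d (b + 1)).sym2) : Set (Sym2 (Site d)))
  · have := iff_of_inter_eq h (e := e) ⟨heK, he⟩
    exact ⟨fun h1 => ⟨this.1 h1.1, heK⟩, fun h1 => ⟨this.2 h1.1, heK⟩⟩
  · exact ⟨fun h1 => absurd h1.2 heK, fun h1 => absurd h1.2 heK⟩

/-- `LINK(U,R)` is determined by the pairs of `Λ(b+1)` touching `U` (`U ⊆ Λ(b)`, `R ⊆ Λ(b+1)`). [folklore] -/
theorem determinedBy_link {b : ℕ} {U R : Finset (Site d)} (hUb : U ⊆ box d b) (hR : R ⊆ box d (b + 1)) :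
    DeterminedBy {ω : BondConfig (Site d) | ∀ r ∈ R, ∀ r' ∈ R, ∃ v ∈ U, ∃ v' ∈ U,
        s(v, r) ∈ ω ∧ s(v', r') ∈ ω ∧ ω ∈ openConnIn (↑U : Set (Site d)) v v'}
      {e : Sym2 (Site d) | e ∈ (↑((box d (b + 1)).sym2) : Set (Sym2 (Site d))) ∧ ∃ u ∈ (↑U : Set (Site d)), u ∈ e} := by
  have hU2 : (↑U : Set (Site d)).sym2 ⊆
      {e : Sym2 (Site d) | e ∈ (↑((box d (b + 1)).sym2) : Set (Sym2 (Site d))) ∧ ∃ u ∈ (↑U : Set (Site d)), u ∈ e} := by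
    intro e he
    induction e using Sym2.ind with
    | h x y =>
      rw [Set.mk_mem_sym2_iff] at he
      exact mem_touching hUb (Finset.mem_coe.1 he.1) (box_mono d (by omega) (hUb (Finset.mem_coe.1 he.2)))
  rw [determinedBy_iff]
  intro ω ω' h
  have hconn : ∀ v v' : Site d, ω ∈ openConnIn (↑U : Set (Site d)) v v' ↔ ω' ∈ openConnIn (↑U : Set (Site d)) v v' :=
    fun v v' => (determinedBy_iff _ _).1 (determinedBy_openConnIn (↑U : Set (Site d)) v v' hU2) ω ω' h
  have hedge : ∀ v ∈ U, ∀ r ∈ R, (s(v, r) ∈ ω ↔ s(v, r) ∈ ω') := fun v hv r hr =>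
    iff_of_inter_eq h (mem_touching hUb hv (hR hr))
  simp only [Set.mem_setOf_eq]
  refine forall₂_congr fun r hr => forall₂_congr fun r' hr' => exists_congr fun v => ?_
  refine and_congr_right fun hv => exists_congr fun v' => and_congr_right fun hv' => ?_
  rw [hedge v hv r hr, hedge v' hv' r' hr', hconn v v']

/-- `LEFT(U,R)` is determined by the pairs of `Λ(b+1)` touching `U`. [folklore] -/
theorem determinedBy_left {b : ℕ} {U R : Finset (Site d)} (hUb : U ⊆ box d b) (hR : R ⊆ box d (b + 1)) :
    DeterminedBy {ω : BondConfig (Site d) | ∃ r ∈ R, ∃ v ∈ U, ω ∈ openConnIn (↑U : Set (Site d)) 0 v ∧ s(v, r) ∈ ω}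
      {e : Sym2 (Site d) | e ∈ (↑((box d (b + 1)).sym2) : Set (Sym2 (Site d))) ∧ ∃ u ∈ (↑U : Set (Site d)), u ∈ e} := by
  have hU2 : (↑U : Set (Site d)).sym2 ⊆
      {e : Sym2 (Site d) | e ∈ (↑((box d (b + 1)).sym2) : Set (Sym2 (Site d))) ∧ ∃ u ∈ (↑U : Set (Site d)), u ∈ e} := by
    intro e he
    induction e using Sym2.ind with
    | h x y =>
      rw [Set.mk_mem_sym2_iff] at he
      exact mem_touching hUb (Finset.mem_coe.1 he.1) (box_mono d (by omega) (hUb (Finset.mem_coe.1 he.2)))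
  rw [determinedBy_iff]
  intro ω ω' h
  simp only [Set.mem_setOf_eq]
  refine exists_congr fun r => and_congr_right fun hr => exists_congr fun v => and_congr_right fun hv => ?_
  rw [(determinedBy_iff _ _).1 (determinedBy_openConnIn (↑U : Set (Site d)) 0 v hU2) ω ω' h,
    iff_of_inter_eq h (mem_touching hUb hv (hR hr))]

/-- `RIGHT(U,R,n)` is determined by the pairs of `Λ(n) ∖ U`. [folklore] -/
theorem determinedBy_right (n : ℕ) (U R : Finset (Site d)) :
    DeterminedBy {ω : BondConfig (Site d) | ∃ r ∈ R, ∃ t ∈ innerBoundary (zdGraph d) (box d n),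
        ω ∈ openConnIn ((↑(box d n) : Set (Site d)) \ ↑U) r t}
      (↑((box d n \ U).sym2) : Set (Sym2 (Site d))) := by
  have h : {ω : BondConfig (Site d) | ∃ r ∈ R, ∃ t ∈ innerBoundary (zdGraph d) (box d n),
      ω ∈ openConnIn ((↑(box d n) : Set (Site d)) \ ↑U) r t} =
      ⋃ r ∈ R, ⋃ t ∈ innerBoundary (zdGraph d) (box d n), openConnIn ((↑(box d n) : Set (Site d)) \ ↑U) r t := by
    ext ω; simp only [Set.mem_setOf_eq, Set.mem_iUnion, exists_prop]
  rw [h]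
  refine DeterminedBy.iUnion fun r => DeterminedBy.iUnion fun _ => DeterminedBy.iUnion fun t => DeterminedBy.iUnion fun _ => ?_
  refine determinedBy_openConnIn _ r t ?_
  rw [Finset.coe_sym2, Finset.coe_sdiff]

/-- The two determining sets are disjoint: a pair of `Λ(n) ∖ U` touches no vertex of `U`. [folklore] -/
theorem disjoint_touching_sdiff (b n : ℕ) (U : Finset (Site d)) :
    Disjoint {e : Sym2 (Site d) | e ∈ (↑((box d (b + 1)).sym2) : Set (Sym2 (Site d))) ∧ ∃ u ∈ (↑U : Set (Site d)), u ∈ e}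
      (↑((box d n \ U).sym2) : Set (Sym2 (Site d))) := by
  rw [Set.disjoint_left]
  rintro e ⟨-, u, hu, hue⟩ he
  rw [Finset.coe_sym2, Finset.coe_sdiff] at he
  induction e using Sym2.ind with
  | h x y =>
    rw [Set.mk_mem_sym2_iff] at he
    rcases Sym2.mem_iff.1 hue with rfl | rfl
    · exact he.1.2 hu
    · exact he.2.2 hu

/-! ## Uniqueness implies the linked rim; every lattice configuration lies in its own datum -/

/-- **`DAT(U,R) ∩ uniqZone a b ⊆ LINK(U,R)`** on lattice configurations (`a ≤ b`, `U ⊆ Λ(b)`): two rim vertices hang off explored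
vertices `v, v' ∈ ∂ⁱⁿΛ(b)`, each joined inside `Λ(b)` to a site of `Λ(a)`; the uniqueness zone joins those sites inside `Λ(b)`, and a
path inside `Λ(b)` from an explored vertex stays in the explored set.  (So the complement of `LINK` on the datum costs at most
`P({0 ↔ ∂ⁱⁿΛ(n)} ∖ uniqZone a b)`, bounded in `PercAnnulusCrossingIICUniquenessJunk.lean`.) [cite: BasuSapozhnikov2017ECP, §2 (F_i)] -/
theorem link_of_dat_of_uniqZone {a b : ℕ} (hab : a ≤ b) {U R : Finset (Site d)} (hUb : U ⊆ box d b)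
    {ω : BondConfig (Site d)} (hω : ω ⊆ (zdGraph d).edgeSet)
    (hD : ω ∩ (↑((box d (b + 1)).sym2) : Set (Sym2 (Site d))) ∈
      explEvent (↑(box d a) : Set (Site d)) ((↑(box d b) : Set (Site d)) \ ↑(box d a)) ↑U ↑R)
    (hU : ω ∈ uniqZone (d := d) a b) :
    ω ∈ {ω : BondConfig (Site d) | ∀ r ∈ R, ∀ r' ∈ R, ∃ v ∈ U, ∃ v' ∈ U,
      s(v, r) ∈ ω ∧ s(v', r') ∈ ω ∧ ω ∈ openConnIn (↑U : Set (Site d)) v v'} := by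
  have hD' := (mem_dat_iff_mem_explEvent (a := a) (R := R) hUb hω).1 hD
  obtain ⟨hSet, hRim⟩ := mem_explEvent_iff.1 hD'
  have hIB : (↑(box d a) : Set (Site d)) ∪ ((↑(box d b) : Set (Site d)) \ ↑(box d a)) = ↑(box d b) := coe_box_union_sdiff hab
  -- each rim vertex hangs off an explored vertex on `∂ⁱⁿΛ(b)`, joined inside `Λ(b)` to a site of `Λ(a)`
  have hang : ∀ r ∈ R, ∃ v ∈ U, s(v, r) ∈ ω ∧ ∃ x ∈ box d a, ω ∈ toBdry b x ∧
      ω ∈ openConnIn (↑(box d b) : Set (Site d)) x v := by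
    intro r hr
    have hr' : r ∈ explRim (↑(box d a) : Set (Site d)) ((↑(box d b) : Set (Site d)) \ ↑(box d a)) ω := by
      rw [hRim]; exact Finset.mem_coe.2 hr
    obtain ⟨-, v, hv, hvr⟩ := mem_explRim_iff.1 hr'
    have hrb : r ∉ box d b := fun h => explRim_disjoint hr' (by rw [hIB]; exact Finset.mem_coe.2 h)
    obtain ⟨hvIB, x, hx, hxv⟩ := mem_explSet_iff_exists.1 hv
    rw [hIB] at hvIB hxv
    have hadj : (zdGraph d).Adj v r := by have := hω hvr; rwa [SimpleGraph.mem_edgeSet] at this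
    have hvB : v ∈ innerBoundary (zdGraph d) (box d b) :=
      mem_innerBoundary_iff.2 ⟨Finset.mem_coe.1 hvIB, r, hrb, hadj⟩
    rw [hSet] at hv
    exact ⟨v, Finset.mem_coe.1 hv, hvr, x, Finset.mem_coe.1 hx, ⟨v, hvB, hxv⟩, hxv⟩
  intro r hr r' hr'
  obtain ⟨v, hv, hvr, x, hx, hbx, hxv⟩ := hang r hr
  obtain ⟨v', hv', hv'r', x', hx', hbx', hx'v'⟩ := hang r' hr'
  refine ⟨v, hv, v', hv', hvr, hv'r', ?_⟩
  have hxx' : ω ∈ openConnIn (↑(box d b) : Set (Site d)) x x' := hU x hx x' hx' hbx hbx'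
  have hvv' : ω ∈ openConnIn (↑(box d b) : Set (Site d)) v v' := by
    rw [openConnIn_comm] at hxv
    exact PlanarDuality.openConnIn_trans (PlanarDuality.openConnIn_trans hxv hxx') hx'v'
  have hvE : v ∈ explSet (↑(box d a) : Set (Site d)) ((↑(box d b) : Set (Site d)) \ ↑(box d a)) ω := by
    rw [hSet]; exact Finset.mem_coe.2 hv
  have h := openConnIn_explSet_of_mem_explSet hvE (by rw [hIB]; exact hvv')
  rwa [hSet] at h

end Summit.CriticalPhenomena.PercolationContinuityZ3.Theorems.Crossing

end
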